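import Literature.NumberTheory.GaloisRepresentations.GalLayerSystemSubgroupLayers
import Literature.NumberTheory.GaloisRepresentations.GalLayerSystemIdele
import HarnessLib

/-!
# `Ext¹_{C_U}(ℤ, Res_U C̄) = 0` for every open subgroup `U ≤ Γ_F`: the class-formation axiom
# `H¹(U, C̄) = 0` of the idèle class formation in door-c4's `Ext` currency (Tate, C–F VII §9 Thm. 9.1,
# §11.1; Milne ADT I Thm. 1.8, hypothesis; Harari §16.1 Def. 16.1)

Topic `NumberTheory/GaloisRepresentations`; namespaces `Literature.NumberTheory.GaloisRepresentations.GalLayerData`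
(the transfer for a general Galois layer system) and `….IdeleClassBar` (the idèle class formation).  Theorems only;
no definition, no named fact, no instance, no `sorry`.  Sequel to `GalLayerSystemSubgroupLayers.lean` (door-c6 g15: the
relative layers `relLayerCohomologyIso : Hⁿ(U ⧸ (U_E ∩ U), (Res_U lim S)^{U_E ∩ U}) ≅ Hⁿ(H_E, Res_{H_E} D.obj E)`),
`Algebra/Homology/DiscreteRepSubgroupLayers.lean` (the vanishing transfer at an open subgroup
`ext_res_eq_zero_of_forall_trace_eq_zero`), `GalLayerSystemIdele.lean` (door-c5 g16: `classData F`, `classData_toD :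
(classData F).toSystem.toD = classBarD F`, `classData_obj`) and the cell's axiom I at finite layers
(`IdeleClassGaloisRep.lean`: `IdeleClassGroup.isZero_H1_res_galoisRep` — `H¹(H, Res C_E) = 0` for EVERY subgroup
`H ≤ Gal(E/F)`, Tate VII §9 Thm. 9.1 (2)).

THE POINT.  Door-c4's Tate duality theorem (`DiscreteRepTateDuality.TateDualityHypotheses`, Milne ADT I Thm. 1.8 / Harari
Thm. 16.21, p589490) asks, for the object `C̄ = classBarD F` of `C_{Γ_F}`, at every open normal subgroup `U ≤ Γ_F`:
`ext_one_eq_zero U : Ext¹_{C_U}(triv ℤ, Res_U C̄) = 0`.  THIS FILE DISCHARGES IT (for every open subgroup, normal or not):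
**`ext_one_res_classBarD_eq_zero`**.  Proof: by the vanishing transfer it suffices that every relative layer
`H¹(U ⧸ (U_E ∩ U), (Res_U C̄)^{U_E ∩ U})` vanishes; by `relLayerCohomologyIso` this is `H¹(H_E, Res_{H_E} C_E)` with
`H_E ≤ Gal(E/F)` the image of `U`, which is zero by axiom I of the idèle class formation at the subgroup `H_E`
(for `U = Gal(F̄/L)`: `H¹(Gal(E/L), C_E) = 0`).  The general transfer `GalLayerData.ext_res_eq_zero_of_forall_subgroupImage`
is stated for any Galois layer system and any degree (used again for `H³` and the Tate–Nakayama tower in the sequel).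

## What is formalised (`F : Type` a number field, `Γ = absoluteGaloisGroup F`)

* `GalLayerData.relLayer_eq_zero_of_subgroupImage` (a relative-layer class vanishes if its image under
  `relLayerCohomologyIso` does), **`GalLayerData.ext_res_eq_zero_of_forall_subgroupImage`** (if every
  `Hⁿ(H_E, Res D.obj E)`, `U_E ≤ U`, vanishes then `Extⁿ_{C_U}(ℤ, Res_U lim S) = 0`),
  **`GalLayerData.ext_res_eq_zero_of_forall_relInf`** (tower form: if every class of every `Hⁿ(H_E, Res D.obj E)` dies
  under some relative inflation `relInf : Hⁿ(H_E, …) → Hⁿ(H_{E'}, …)`, then `Extⁿ_{C_U}(ℤ, Res_U lim S) = 0`).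
* **`IdeleClassBar.ext_one_res_classBarD_eq_zero`**: `Ext¹_{C_U}(ℤ, Res_U C̄) = 0` for every open `U ≤ Γ_F`;
  `IdeleClassBar.ext_one_res_classBarD_eq_zero_openNormal` (the `OpenNormalSubgroup` form of door-c4's field);
  `IdeleClassBar.ext_one_classBarD_eq_zero` (`U = Γ_F`: `Ext¹_{C_Γ}(ℤ, C̄) = 0`, via door-c4's own (d)).

Written for Route A of the Poitou–Tate programme of crux `AnticycControlAdditiveK` (cell bsd-schneider, item 19295), seat
door-c6 gen 15.  HONEST FRAMING: this is ONE of the six class-formation hypotheses of the abstract duality theorem for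
`(Γ_F, C̄)`; no case of Poitou–Tate duality and no case of BSD is proved here.

## References
* J. W. S. Cassels, A. Fröhlich (eds.), *Algebraic Number Theory* (1967), Ch. VII (J. Tate) §9 Thm. 9.1, §11.1.
  [CasselsFrohlichANT1967]
* J. S. Milne, *Arithmetic Duality Theorems* (2nd ed. 2006), I §1, Theorem 1.8 (hypotheses) and §4 (the class
  formation `(G_S, C_S)`). [MilneADT2006]
* D. Harari, *Galois Cohomology and Class Field Theory* (2020), §16.1 Definition 16.1, §16.3. [Harari2020]
* J.-P. Serre, *Galois Cohomology*, Springer (1997), I §2.2 Proposition 8. [SerreGaloisCohomology1997]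
-/

noncomputable section

open CategoryTheory groupCohomology
open Field (absoluteGaloisGroup)
open Literature.Algebra.Homology
open Literature.NumberTheory.Automorphic
open scoped Classical

namespace Literature.NumberTheory.GaloisRepresentations

open IdeleClassBar

namespace GalLayerData

variable {F : Type} [Field F] [NumberField F] (D : GalLayerData F) (U : Subgroup (absoluteGaloisGroup F))

omit [NumberField F] in
/-- A class of the relative layer `Hⁿ(U ⧸ (U_E ∩ U), (Res_U lim S)^{U_E ∩ U})` vanishes as soon as its image in
`Hⁿ(H_E, Res D.obj E)` under `relLayerCohomologyIso` does. [cite: SerreGaloisCohomology1997, I §2.2 Proposition 8] -/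
theorem relLayer_eq_zero_of_subgroupImage {E : GalLayer F}
    (hE : (E.openNormalSubgroup : Subgroup (absoluteGaloisGroup F)) ≤ U) (n : ℕ)
    (c : groupCohomology (D.relLayerRep U E) n) (hc : (D.relLayerCohomologyIso hE n).hom c = 0) : c = 0 := by
  rw [← CategoryTheory.Iso.hom_inv_id_apply (D.relLayerCohomologyIso hE n) c, hc, map_zero]

/-- **Transfer**: if every `Hⁿ(H_E, Res_{H_E} D.obj E)` (`U_E ≤ U`, `H_E` the image of `U` in `Gal(E/F)`) vanishes, then
`Extⁿ_{C_U}(ℤ, Res_U lim S) = 0` (`U` open; the trace layers are indexed by the layers `E` with `U_E ≤ U` through the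
dictionary `GalLayer F ≃o (OpenNormalSubgroup Γ_F)ᵒᵈ`).
[cite: SerreGaloisCohomology1997, I §2.2 Proposition 8][cite: Harari2020, §16.1 Definition 16.1] -/
theorem ext_res_eq_zero_of_forall_subgroupImage (hU : IsOpen (U : Set (absoluteGaloisGroup F))) (n : ℕ)
    (h : ∀ (E : GalLayer F), (E.openNormalSubgroup : Subgroup (absoluteGaloisGroup F)) ≤ U →
      ∀ c : groupCohomology (Rep.res (GalLayer.subgroupImage U E).subtype (D.obj E)) n, c = 0)
    (x : Abelian.Ext (DiscreteRep.triv (Γ := U) ℤ) ((DiscreteRep.resD ℤ U).obj D.toSystem.toD) n) : x = 0 := by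
  refine DiscreteRep.LayerColimit.ext_res_eq_zero_of_forall_trace_eq_zero U hU n D.toSystem.toD
    (fun V hVU c => ?_) x
  obtain ⟨E, rfl⟩ : ∃ E : GalLayer F, E.openNormalSubgroup = V :=
    ⟨GalLayer.ofOpenNormalSubgroup V, GalLayer.openNormalSubgroup_ofOpenNormalSubgroup V⟩
  exact D.relLayer_eq_zero_of_subgroupImage U hVU n c (h E hVU _)

/-- **Transfer, tower form**: if every class of every `Hⁿ(H_E, Res_{H_E} D.obj E)` (`U_E ≤ U`) is killed by the relative
inflation `relInf` to some layer `E' ≥ E`, then `Extⁿ_{C_U}(ℤ, Res_U lim S) = 0` (the shape of Milne ADT I Lemma 1.9 (b)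
/ Harari Lemma 16.20 at an open subgroup). [cite: SerreGaloisCohomology1997, I §2.2 Proposition 8][cite: Harari2020, §16.3 Lemma 16.20] -/
theorem ext_res_eq_zero_of_forall_relInf (hU : IsOpen (U : Set (absoluteGaloisGroup F))) (n : ℕ)
    (h : ∀ (E : GalLayer F), (E.openNormalSubgroup : Subgroup (absoluteGaloisGroup F)) ≤ U →
      ∀ c : groupCohomology (Rep.res (GalLayer.subgroupImage U E).subtype (D.obj E)) n,
      ∃ (E' : GalLayer F) (hEE' : E ≤ E'), D.relInf U hEE' n c = 0)
    (x : Abelian.Ext (DiscreteRep.triv (Γ := U) ℤ) ((DiscreteRep.resD ℤ U).obj D.toSystem.toD) n) : x = 0 := by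
  refine DiscreteRep.LayerColimit.ext_res_eq_zero_of_forall_trace U hU n D.toSystem.toD (fun V hVU c => ?_) x
  obtain ⟨E, rfl⟩ : ∃ E : GalLayer F, E.openNormalSubgroup = V :=
    ⟨GalLayer.ofOpenNormalSubgroup V, GalLayer.openNormalSubgroup_ofOpenNormalSubgroup V⟩
  obtain ⟨E', hEE', h0⟩ := h E hVU ((D.relLayerCohomologyIso hVU n).hom c)
  have hE' : (E'.openNormalSubgroup : Subgroup (absoluteGaloisGroup F)) ≤ U :=
    (GalLayer.coe_openNormalSubgroup_le hEE').trans hVU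
  refine ⟨E'.openNormalSubgroup, GalLayer.coe_openNormalSubgroup_le hEE', ?_⟩
  refine D.relLayer_eq_zero_of_subgroupImage U hE' n _ ?_
  rw [D.relLayerCohomologyIso_stepG hVU hE' hEE' n c, h0]

end GalLayerData

namespace IdeleClassBar

variable {F : Type} [Field F] [NumberField F]

/-- **`Ext¹_{C_U}(ℤ, Res_U C̄) = 0` for every open subgroup `U ≤ Γ_F`** — the class-formation axiom `H¹(U, C̄) = 0` of
the idèle class formation `(Γ_F, C̄ = lim→ C_E)` in door-c4's `Ext` currency, from axiom I at the finite layers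
(`H¹(H_E, Res C_E) = 0` for every subgroup `H_E ≤ Gal(E/F)`, Tate VII §9 Thm. 9.1 (2)) through the relative layers.
[cite: CasselsFrohlichANT1967, Ch. VII §9 Thm. 9.1][cite: MilneADT2006, I Theorem 1.8] -/
theorem ext_one_res_classBarD_eq_zero (U : Subgroup (absoluteGaloisGroup F))
    (hU : IsOpen (U : Set (absoluteGaloisGroup F)))
    (x : Abelian.Ext (DiscreteRep.triv (Γ := U) ℤ) ((DiscreteRep.resD ℤ U).obj (classBarD F)) 1) : x = 0 := by
  -- `(classData F).toSystem.toD = classBarD F` definitionally (`classData_toD`)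
  refine (classData F).ext_res_eq_zero_of_forall_subgroupImage U hU 1 (fun E _ c => ?_) x
  haveI := E.numberField
  haveI := E.isGalois
  -- `(classData F).obj E = galoisRep F E` definitionally (`classData_obj`)
  exact @Subsingleton.elim _ (ModuleCat.subsingleton_of_isZero
    (IdeleClassGroup.isZero_H1_res_galoisRep (F := F) (E := E.1) (GalLayer.subgroupImage U E))) c 0

/-- **Door-c4's field `TateDualityHypotheses.ext_one_eq_zero` for `C̄`**, verbatim shape: for every open normal subgroup
`U` of `Γ_F`, `Ext¹_{C_U}(triv ℤ, Res_U C̄) = 0`. [cite: MilneADT2006, I Theorem 1.8][cite: CasselsFrohlichANT1967, Ch. VII §9 Thm. 9.1] -/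
theorem ext_one_res_classBarD_eq_zero_openNormal (U : OpenNormalSubgroup (absoluteGaloisGroup F))
    (x : Abelian.Ext (DiscreteRep.triv (k := ℤ) (Γ := (U : Subgroup (absoluteGaloisGroup F))) ℤ)
      ((DiscreteRep.resD ℤ (U : Subgroup (absoluteGaloisGroup F))).obj (classBarD F)) 1) : x = 0 :=
  ext_one_res_classBarD_eq_zero (U : Subgroup (absoluteGaloisGroup F)) (DiscreteRep.LayerColimit.coe_isOpen U) x

/-- **`Ext¹_{C_{Γ_F}}(ℤ, C̄) = 0`** — the absolute case `H¹(Γ_F, C̄) = 0` (Tate VII §11.1 in the limit), through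
door-c4's (d) directly: every layer `H¹(Γ_F ⧸ U_E, C̄^{U_E}) ≅ H¹(Gal(E/F), C_E)` (door-c5 `layerCohomologyIso`) vanishes.
[cite: CasselsFrohlichANT1967, Ch. VII §9 Thm. 9.1 and §11.1][cite: MilneADT2006, I Theorem 1.8] -/
theorem ext_one_classBarD_eq_zero
    (x : Abelian.Ext (DiscreteRep.triv (Γ := absoluteGaloisGroup F) ℤ) (classBarD F) 1) : x = 0 := by
  refine DiscreteRep.LayerColimit.ext_eq_zero_of_forall_exists_stepG_eq_zero 1 (classBarD F) (fun V c => ?_) x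
  refine ⟨V, le_rfl, ?_⟩
  obtain ⟨E, rfl⟩ : ∃ E : GalLayer F, E.openNormalSubgroup = V :=
    ⟨GalLayer.ofOpenNormalSubgroup V, GalLayer.openNormalSubgroup_ofOpenNormalSubgroup V⟩
  haveI := E.numberField
  haveI := E.isGalois
  haveI := ModuleCat.subsingleton_of_isZero (IdeleClassGroup.isZero_H1_galoisRep (F := F) (E := E.1))
  have hc : c = 0 := by
    rw [← CategoryTheory.Iso.hom_inv_id_apply (layerCohomologyIso E 1) c,
      Subsingleton.elim ((layerCohomologyIso E 1).hom c) 0, map_zero]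
  rw [hc, map_zero]

end IdeleClassBar

end Literature.NumberTheory.GaloisRepresentations

end
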